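import Literature.Topology.FourManifolds.FingerBand
import Literature.Topology.FourManifolds.K1Loop2Up
import HarnessLib

/-!
# The upper fingertip half of the controlled-descent profile is a graph over the twisted height

Topic `Literature/Topology/FourManifolds`; fact seat `provefact-IsStrictHandleSlide.isSurgery`
(R. C. Kirby, *The Topology of 4-Manifolds*, LNM 1374 (1989), Ch. I §4, Fig. 4.2; remaining content:
the named fact (S) `Literature.Topology.FourManifolds.FramedLink.IsStrictHandleSlide.slideModel`).
Mirror of `FingerBand.lean`: above the axis height `h_A` the slice angle `Θ` of the fingertip is
negative, and by the symmetry `twistAngle c r (-θ) = -twistAngle c r θ` the upper half, read in the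
reflected height `u = -h` with radius `rsu (-u)` and angle `-Θ (-u) ≥ 0`, is again a `FingerHyp`
(`K1Loop2Data.FingerAngleData.fingerHypUp`, using the facts of `K1Loop2Up.lean`). Consequently
the true twisted height `h ↦ rsu h · sin (twistAngle c (rsu h) (Θ h))` is strictly decreasing on
`[h_A, h_Dᵘ]` as well (`strictAntiOn_fingerY_up`), reaching `-r_Dᵘ` at the upper tip.

## References

* R. C. Kirby, *The Topology of 4-Manifolds*, LNM 1374, Springer (1989), Ch. I §4. [Kirby1989]
-/

open scoped Topology ContDiff
open Set Real Filter

noncomputable section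

namespace Literature.Topology.FourManifolds

namespace K1Loop2Data

variable {L : K1Loop2Data}

/-- **Hypotheses for the upper fingertip half** (in addition to the lower `FingerAngleData`): the
angle bounds up to the upper tip, the upper tip condition and the four conditions with the upper
constants. [cite: Kirby1989, Ch. I §4] -/
structure FingerAngleDataUp (D : L.FingerAngleData) where
  hA_ge : L.hcl ≤ D.hA
  hA_le_hgu : D.hA ≤ L.hgu
  ΘDu_lt : -D.Θ L.hDu < π
  Θ_deriv_up : ∀ h ∈ Icc D.hA L.hDu, -D.MΘ ≤ deriv D.Θ h ∧ deriv D.Θ h ≤ -D.mΘ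
  rDu_le : L.rDu ≤ 2
  tip_up : exp (D.c * L.rDu) * tan (-D.Θ L.hDu / 2) = 1
  condF1u : |D.c| * (L.rDu - 1) + exp (|D.c| * 2) / cos (-D.Θ L.hDu / 2) ^ 2 * D.MΘ * (L.hDu - L.hgu) ≤ 2⁻¹
  condF1u' : 8 * |D.c| * (|D.c| * (L.rDu - 1) + exp (|D.c| * 2) / cos (-D.Θ L.hDu / 2) ^ 2 * D.MΘ * (L.hDu - L.hgu)) ≤ 1
  condF2u : 16 * (exp (|D.c| * 2) / cos (-D.Θ L.hDu / 2) ^ 2 * D.MΘ) *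
    (|D.c| * (L.rDu - 1) + exp (|D.c| * 2) / cos (-D.Θ L.hDu / 2) ^ 2 * D.MΘ * (L.hDu - L.hgu)) < L.lam
  condF3u : |D.c| * (L.rDu - 1) < exp (-(|D.c| * 2)) * D.mΘ * (L.hDu - L.hgu)
  condF4u : (1 + L.CT) * L.lam * |D.c| < exp (-(|D.c| * 2)) * D.mΘ

namespace FingerAngleDataUp

variable {D : L.FingerAngleData}

/-- `hgu_lt_hDu` (auxiliary). [folklore] -/
theorem hgu_lt_hDu : L.hgu < L.hDu := by
  have h1 := L.hgu_le; have h2 := L.β_pos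
  show L.hgu < 1 - L.du.Hh L.du.tD; linarith

/-- `hA_lt_hDu` (auxiliary). [folklore] -/
theorem hA_lt_hDu (U : FingerAngleDataUp D) : D.hA < L.hDu := U.hA_le_hgu.trans_lt hgu_lt_hDu

/-- `Icc_sub_win` (auxiliary). [folklore] -/
theorem Icc_sub_win {h : ℝ} (hh : h ∈ Icc D.hA L.hDu) : h ∈ Ioo (10⁻¹ : ℝ) (9 / 10) :=
  ⟨by linarith [L.hD_mem_win.1, D.hD_le_hA, hh.1], by linarith [L.hDu_mem_win.2, hh.2]⟩

/-- `hasDerivAt_Θ` (auxiliary). [folklore] -/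
theorem hasDerivAt_Θ_up {h : ℝ} (hh : h ∈ Icc D.hA L.hDu) : HasDerivAt D.Θ (deriv D.Θ h) h :=
  ((D.Θ_smooth.differentiableOn (by simp)).differentiableAt
    (Ioo_mem_nhds (Icc_sub_win hh).1 (Icc_sub_win hh).2)).hasDerivAt

/-- `strictAntiOn_Θ_up` (auxiliary). [folklore] -/
theorem strictAntiOn_Θ_up (U : FingerAngleDataUp D) : StrictAntiOn D.Θ (Icc D.hA L.hDu) := by
  refine strictAntiOn_of_deriv_neg (convex_Icc _ _) (fun h hh ↦ (hasDerivAt_Θ_up hh).continuousAt.continuousWithinAt) ?_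
  intro h hh
  rw [interior_Icc] at hh
  have := (U.Θ_deriv_up h (Ioo_subset_Icc_self hh)).2
  linarith [D.mΘ_pos]

/-- Reflection of the parameter: `u ∈ [-hDu, -hA] ↔ -u ∈ [hA, hDu]`. [folklore] -/
theorem neg_mem {u : ℝ} (hu : u ∈ Icc (-L.hDu) (-D.hA)) : -u ∈ Icc D.hA L.hDu := ⟨by linarith [hu.2], by linarith [hu.1]⟩

/-- **The `FingerHyp` of the upper fingertip half, in the reflected height `u = -h`.** [cite: Kirby1989, Ch. I §4] -/
def fingerHypUp (U : FingerAngleDataUp D) : FingerHyp where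
  c := D.c
  hD := -L.hDu
  hg := -L.hgu
  hA := -D.hA
  r := fun u ↦ L.rsu (-u)
  θ := fun u ↦ -D.Θ (-u)
  dr := fun u ↦ -deriv L.rsu (-u)
  dθ := fun u ↦ deriv D.Θ (-u)
  rD := L.rDu
  lam := L.lam
  mΘ := D.mΘ
  MΘ := D.MΘ
  hDg := by linarith [hgu_lt_hDu (L := L)]
  hgA := by linarith [U.hA_le_hgu]
  hasDeriv_r := fun u _ ↦ by
    have h := ((L.contDiff_rsu.differentiable (by simp) (-u)).hasDerivAt).comp u (hasDerivAt_neg u)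
    refine (h.congr_of_eventuallyEq (Eventually.of_forall fun v ↦ rfl)).congr_deriv ?_; ring
  hasDeriv_θ := fun u hu ↦ by
    have h := ((hasDerivAt_Θ_up (neg_mem hu)).comp u (hasDerivAt_neg u)).neg
    refine (h.congr_of_eventuallyEq (Eventually.of_forall fun v ↦ rfl)).congr_deriv ?_
    ring
  θ_mem := fun u hu ↦ by
    have hmu := neg_mem hu
    have h1 : D.Θ (-u) ≤ D.Θ D.hA := (strictAntiOn_Θ_up U).antitoneOn ⟨le_rfl, (hA_lt_hDu U).le⟩ hmu hmu.1
    have h2 : D.Θ L.hDu ≤ D.Θ (-u) := (strictAntiOn_Θ_up U).antitoneOn hmu ⟨(hA_lt_hDu U).le, le_rfl⟩ hmu.2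
    rw [D.Θ_hA] at h1
    show -D.Θ (-u) ∈ Icc 0 (-D.Θ (- -L.hDu))
    rw [neg_neg]
    exact ⟨by linarith, by linarith⟩
  θ_pos := fun u hu ↦ by
    have hmu : -u ∈ Ioc D.hA L.hDu := ⟨by linarith [hu.2], by linarith [hu.1]⟩
    have := (strictAntiOn_Θ_up U) ⟨le_rfl, (hA_lt_hDu U).le⟩ ⟨hmu.1.le, hmu.2⟩ hmu.1
    rw [D.Θ_hA] at this
    show 0 < -D.Θ (-u); linarith
  θD_lt := by show -D.Θ (- -L.hDu) < π; rw [neg_neg]; exact U.ΘDu_lt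
  r_mem := fun u hu ↦ by
    have hmu := neg_mem hu
    exact ⟨L.rlow_gt.le.trans (L.rsu_mem' hmu.2).1, (L.rsu_mem' hmu.2).2⟩
  rD_le := U.rDu_le
  r_hD := by show L.rsu (- -L.hDu) = L.rDu; rw [neg_neg]; exact L.rsu_hDu
  dr_nonpos := fun u hu ↦ by
    have := L.deriv_rsu_nonneg (neg_mem hu).2; show -deriv L.rsu (-u) ≤ 0; linarith
  lam_pos := L.lam_pos
  dr_le := fun u hu ↦ by
    have := L.deriv_rsu_ge (h := -u) ⟨by linarith [hu.2], by linarith [hu.1]⟩; show -deriv L.rsu (-u) ≤ -L.lam; linarith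
  Lam := (1 + L.CT) * L.lam
  dr_ge := fun u hu ↦ by
    have hle : -u ≤ L.hDu - L.β := by
      have h1 := L.hgu_le
      have e : L.hDu = 1 - L.du.Hh L.du.tD := rfl
      rw [e]; linarith [hu.1]
    have := L.deriv_rsu_le hle; show -((1 + L.CT) * L.lam) ≤ -deriv L.rsu (-u); linarith
  mΘ_pos := D.mΘ_pos
  dθ_mem := fun u hu ↦ U.Θ_deriv_up (-u) (neg_mem hu)
  tip := by show rexp (D.c * L.rDu) * tan (-D.Θ (- -L.hDu) / 2) = 1; rw [neg_neg]; exact U.tip_up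
  condF1 := by
    show |D.c| * (L.rDu - 1) + rexp (|D.c| * 2) / cos (-D.Θ (- -L.hDu) / 2) ^ 2 * D.MΘ * (-L.hgu - -L.hDu) ≤ 2⁻¹
    rw [neg_neg]; have := U.condF1u; linarith
  condF1' := by
    show 8 * |D.c| * (|D.c| * (L.rDu - 1) + rexp (|D.c| * 2) / cos (-D.Θ (- -L.hDu) / 2) ^ 2 * D.MΘ * (-L.hgu - -L.hDu)) ≤ 1
    rw [neg_neg]; have := U.condF1u'; linarith
  condF2 := by
    show 16 * (rexp (|D.c| * 2) / cos (-D.Θ (- -L.hDu) / 2) ^ 2 * D.MΘ) *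
      (|D.c| * (L.rDu - 1) + rexp (|D.c| * 2) / cos (-D.Θ (- -L.hDu) / 2) ^ 2 * D.MΘ * (-L.hgu - -L.hDu)) < L.lam
    rw [neg_neg]; have := U.condF2u; linarith
  condF3 := by
    show |D.c| * (L.rDu - 1) < rexp (-(|D.c| * 2)) * D.mΘ * (-L.hgu - -L.hDu)
    have := U.condF3u; linarith
  condF4 := U.condF4u

/-- `fingerHypUp_y` (auxiliary). [folklore] -/
theorem fingerHypUp_y (U : FingerAngleDataUp D) (u : ℝ) :
    (fingerHypUp U).y u = -(L.rsu (-u) * sin (twistAngle D.c (L.rsu (-u)) (D.Θ (-u)))) := by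
  simp only [FingerHyp.y, FingerHyp.α, fingerHypUp, twistAngle_neg, sin_neg, mul_neg]

/-- **The upper fingertip half is a graph over the twisted height**: the true twisted height
`h ↦ rsu h · sin (twistAngle c (rsu h) (Θ h))` is strictly decreasing on `[h_A, h_Dᵘ]`.
[cite: Kirby1989, Ch. I §4] -/
theorem strictAntiOn_fingerY_up (U : FingerAngleDataUp D) :
    StrictAntiOn (fun h ↦ L.rsu h * sin (twistAngle D.c (L.rsu h) (D.Θ h))) (Icc D.hA L.hDu) := by
  intro h hh h' hh' hlt
  -- in the reflected height `yᵘ (-h) = -y h` is strictly decreasing in `-h`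
  have hanti := (fingerHypUp U).strictAntiOn_y
  have hm : -h' ∈ Icc (-L.hDu) (-D.hA) := ⟨by linarith [hh'.2], by linarith [hh'.1]⟩
  have hm' : -h ∈ Icc (-L.hDu) (-D.hA) := ⟨by linarith [hh.2], by linarith [hh.1]⟩
  have := hanti hm hm' (by linarith)
  change (fingerHypUp U).y (-h) < (fingerHypUp U).y (-h') at this
  rw [fingerHypUp_y U, fingerHypUp_y U, neg_neg, neg_neg] at this
  simpa using this

/-- At the upper tip the true twisted height is `-r_Dᵘ`. [folklore] -/
theorem fingerY_hDu (U : FingerAngleDataUp D) : L.rsu L.hDu * sin (twistAngle D.c (L.rsu L.hDu) (D.Θ L.hDu)) = -L.rDu := by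
  have h := (fingerHypUp U).y_hD
  have e : (fingerHypUp U).hD = -L.hDu := rfl
  rw [e, fingerHypUp_y U, neg_neg] at h
  have e' : (fingerHypUp U).rD = L.rDu := rfl
  rw [e'] at h
  linarith

/-- On the upper half the fingertip radius is the full profile radius `rstar` (the lower clamp is
active above `hcl ≤ h_A`). [folklore] -/
theorem rstar_eq_rsu (U : FingerAngleDataUp D) {h : ℝ} (hh : h ∈ Icc D.hA L.hDu) : L.rstar h = L.rsu h :=
  L.rstar_of_ge_hcl (U.hA_ge.trans hh.1)

end FingerAngleDataUp

end K1Loop2Data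

end Literature.Topology.FourManifolds
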